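/-
Copyright (c) 2026 the pub-hodgecm-mathlib formalisation cell (harness21).  Prover seat hodgecm-mathlib-K2E2-p12 (g5): Track B «K2-LIT», ENGINE E1,
h413 = stmt-HodgeConjecture-24833; (q10) «R7₃-SCALAR» FILE 2(b) «transport», SPLIT part (pointwise): the `U(2,1)` big-cell height at a split place in
Gindikin–Karpelevich coordinates.
-/
import Summits.HodgeConjecture.HodgeConjecture.Theorems.K2E1IntertwiningLocalFactorU3Height    -- ★ (this seat): `corner_eq_quadraticLocalEquiv`, `quadraticLocalEquiv_apply_place`, `ne_one_of_apply_eq_neg`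
import Literature.NumberTheory.GelbartRogawski1991.LocalUnitarySplitPlaceDarboux                -- ★ `splitSqrt`, `splitSqrt_mul_self`, `splitSqrt_galInv`, `splitCoord`, `toPlace_splitCoord`, `valued_toPlace_of_split`
import Literature.NumberTheory.Automorphic.AdicCompletionDegreeOnePlaceEquiv                     -- ★ `absNorm_eq_absNorm_under_of_smul_ne` (`q_w = q_v` at a split place)
import HarnessLib

/-!
# K2·E1 — `K2E1IntertwiningLocalFactorU3HeightSplit` ((q10) «R7₃-SCALAR» FILE 2(b), split part): AT A SPLIT PLACE THE `U(2,1)` BIG-CELL HEIGHT IS THE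
# GINDIKIN–KARPELEVICH `GL₃` INTEGRAND — `max(1,‖X_w‖,‖Z_w‖)·max(1,‖X_w̄‖,‖Z_w̄‖) = max(1,|x|,|z|)·max(1,|y|,|z − xy|)`, `x = a + δ_w b`, `y = −(a − δ_w b)`, `z = δ_w t − ½·x·(a − δ_w b)`

Track B ∕ K2-LIT, crux h413 = `stmt-HodgeConjecture-24833`, route of record `HCCMUnconditional`; cell `hodgecm-mathlib`, squad K2, ENGINE E1 (campaign «EIS-RANK-ONE», R7 at
`N = 3`).  THEOREMS ONLY (no `def`, no instance, no notation, no named-fact hypothesis, no `sorry`; default heartbeats); lane `--supports stmt-HodgeConjecture-24833 --as helper`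
(count-neutral).  Currency: ★ `QuadraticLocalBaseChange` (`LocalRing E v = Π_{w∣v} E_w`, `ι_w = toPlace v w`, `Ψ_v = quadraticLocalEquiv`) and ★
`LocalUnitarySplitPlaceDarboux` (`δ_w = splitSqrt … v w ∈ F_v`, the square root of `d = δ²` singled out by the split place `w`: `ι_w(δ_w) = δ`, `δ_{w̄} = −δ_w`, `w̄ = c⁻¹•w`).

THE MATHEMATICS [CasselsFrohlichANT1967, Ch. II §10; Langlands1971, §3; MoeglinWaldspurger1995, II.1.7].  At a place `v` of `F` SPLIT in `E` (`c • w ≠ w`, `w̄ = c⁻¹ • w ≠ w` the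
other place, ★ `PlacesOver.eq_or_eq_galInv`), `E ⊗_F F_v = E_w × E_w̄` with `ι_w, ι_w̄ : F_v ≅ E_w, E_w̄` (`e = f = 1`, ★ `valued_toPlace_of_split`, ★ `absNorm_eq_absNorm_under_of_smul_ne`)
and `Ψ_v(a, b) = (ι_w(a + δ_w b), ι_w̄(a − δ_w b))` (★ `toPlace_splitCoord`, `splitSqrt_galInv`).  So for the last-row entries `X = Ψ_v(a,b)`, `Z = ι t·δ − ½X·σX = Ψ_v(−½(a² − d b²), t)`
(★ `corner_eq_quadraticLocalEquiv`) of `ι(w₀)·u(X, θt)` in `U(J₃)`, with `x := a + δ_w b`, `x̄ := a − δ_w b` (`a² − d b² = x·x̄`, `d = δ_w²`) and `z := δ_w t − ½·x·x̄`: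
`X_w = ι_w x`, `X_w̄ = ι_w̄ x̄`, `Z_w = ι_w z`, `Z_w̄ = ι_w̄(−δ_w t − ½ x x̄) = ι_w̄(−(z − x·(−x̄)))`.  Hence
* §1 **components**: `quadraticLocalEquiv_apply_eq_toPlace_of_split` (`Ψ(a,b)_w = ι_w(a + δ_w b)`), `…_galInv_…` (`Ψ(a,b)_w̄ = ι_w̄(a − δ_w b)`), and the corner at `w`, `w̄`;
* §2 **norms** (`‖·‖ = normAbs`, `q_w = q_v`): `‖X_w‖_w = ‖x‖_v`, `‖X_w̄‖ = ‖x̄‖_v`, `‖Z_w‖ = ‖z‖_v`, `‖Z_w̄‖ = ‖z − x·y‖_v` with `y = −x̄`;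
* §3 **HEAD `prod_max_one_norm_height_eq_gl3_of_split`**: `max(1,‖X_w‖,‖Z_w‖)·max(1,‖X_w̄‖,‖Z_w̄‖) = max(1,|x|,|z|)·max(1,|y|,|z − x y|)` — LITERALLY the integrand
  `max 1 (max |x| |z|) * max 1 (max |y| |z - x*y|)` of ★ `K2E1GindikinKarpelevichSplitGL3.integral_bigCell_spherical_gl3_eq` at `(x, y, z) = (a + δ_w b, −(a − δ_w b), δ_w t − ½(a + δ_w b)(a − δ_w b))`,
  and **`prod_placesOver_max_one_norm_height_eq_gl3_of_split`**: the same for the product over ALL `w' ∣ v` (`= {w, w̄}`).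
NOT HERE: the measure side of the split transport (the map `(a, b, t) ↦ (x, y, z)` preserves `μ_v ⊗ μ_v ⊗ μ_v` when `‖2‖_v = ‖δ_w‖_v = 1` — `MeasurePreserving.skew_product`), FILE 3.
HONEST LABEL: HC_CM is proved only modulo the 7 printed citations (2 remaining named inputs: hLiu418 = `stmt-HodgeConjecture-24832`, h413 = `stmt-HodgeConjecture-24833`) until rung 0
closes; this file asserts no named fact and closes no socket; count-neutral.

## References
* [CasselsFrohlichANT1967] J. W. S. Cassels, A. Fröhlich (eds.), *Algebraic Number Theory* (1967): Ch. II §10 (`L ⊗_K K_v = Π_{w∣v} L_w`; split places).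
* [Langlands1971] R. P. Langlands, *Euler Products* (1971): §3.
* [MoeglinWaldspurger1995] C. Mœglin, J.-L. Waldspurger, *Spectral Decomposition and Eisenstein Series* (1995): II.1.7, IV.1.11.
-/

set_option autoImplicit false
set_option linter.dupNamespace false -- the mandated namespace repeats `HodgeConjecture.HodgeConjecture`

noncomputable section

open NumberField IsDedekindDomain
open scoped NNReal
open Literature.NumberTheory.Automorphic Literature.NumberTheory.Automorphic.UnitaryGroup
open Literature.NumberTheory.Automorphic.UnitaryGroup.QuadraticCoordinates
open Literature.NumberTheory.GaloisRepresentations.IsNonarchimedeanLocalField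
open Literature.NumberTheory.GelbartRogawski1991.UnitaryDualPair.LocalSplitting
  (splitSqrt splitSqrt_mul_self splitSqrt_galInv splitCoord toPlace_splitCoord valued_toPlace_of_split)
open Summit.HodgeConjecture.HodgeConjecture.Cruxes.H413.K2E1IntertwiningLocalFactorU3Height
  (corner_eq_quadraticLocalEquiv quadraticLocalEquiv_apply_place ne_one_of_apply_eq_neg)

namespace Summit.HodgeConjecture.HodgeConjecture.Cruxes.H413.K2E1IntertwiningLocalFactorU3HeightSplit

variable {F : Type} [Field F] [NumberField F] (E : Type) [Field E] [NumberField E] [Algebra F E]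
  [Algebra.IsQuadraticExtension F E] (c : E ≃ₐ[F] E) {δ : E} (hcδ : c δ = -δ) (hδ : δ ≠ 0) {d : F}
  (hd : δ * δ = algebraMap F E d) (v : HeightOneSpectrum (𝓞 F)) (w : PlacesOver E v)

/-! ## §0 The other place `w̄ = c⁻¹ • w` is split too -/

include hcδ hδ in
/-- At a split place, `c • w̄ ≠ w̄` for `w̄ = c⁻¹ • w` (`c⁻¹ = c`, `c • (c • w) = w ≠ c • w`). [cite: CasselsFrohlichANT1967, Ch. II §10] -/
theorem smul_galInv_ne (hw : c • w.1 ≠ w.1) : c • (PlacesOver.galInv c w).1 ≠ (PlacesOver.galInv c w).1 := by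
  have hc : c⁻¹ = c := algEquiv_inv_eq_self F (ne_one_of_apply_eq_neg E c hcδ hδ)
  intro h
  apply hw
  have h' : c • c • w.1 = c • w.1 := by simpa [PlacesOver.galInv, hc] using h
  rw [smul_smul, algEquiv_mul_self_eq_one F (ne_one_of_apply_eq_neg E c hcδ hδ), one_smul] at h'
  exact h'.symm

/-! ## §1 Components of `Ψ_v(a, b)` and of the corner at the two places above a split `v` -/

include hd in
/-- **`Ψ_v(a,b)_w = ι_w(a + δ_w b)`** at a split place (★ `toPlace_splitCoord` with `splitCoord w (Ψ(a,b)) = a + δ_w b`). [cite: CasselsFrohlichANT1967, Ch. II §10] -/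
theorem quadraticLocalEquiv_apply_eq_toPlace_of_split (hw : c • w.1 ≠ w.1) (a b : v.adicCompletion F) :
    quadraticLocalEquiv E v c hcδ hδ (a, b) w = toPlace v w (a + splitSqrt F E c hcδ hδ v w * b) := by
  rw [← toPlace_splitCoord F E c hcδ hδ hd v w hw (quadraticLocalEquiv E v c hcδ hδ (a, b)), splitCoord]
  congr 1
  change QuadraticCoordinates.re (quadraticLocalEquiv E v c hcδ hδ).toLinearEquiv.toAddEquiv ((quadraticLocalEquiv E v c hcδ hδ).toLinearEquiv.toAddEquiv (a, b)) +
      splitSqrt F E c hcδ hδ v w *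
        QuadraticCoordinates.im (quadraticLocalEquiv E v c hcδ hδ).toLinearEquiv.toAddEquiv ((quadraticLocalEquiv E v c hcδ hδ).toLinearEquiv.toAddEquiv (a, b)) = _
  rw [QuadraticCoordinates.re_apply, QuadraticCoordinates.im_apply]

include hd in
/-- **`Ψ_v(a,b)_w̄ = ι_w̄(a − δ_w b)`** (`δ_{w̄} = −δ_w`, ★ `splitSqrt_galInv`). [cite: CasselsFrohlichANT1967, Ch. II §10] -/
theorem quadraticLocalEquiv_apply_galInv_eq_toPlace_of_split (hw : c • w.1 ≠ w.1) (a b : v.adicCompletion F) :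
    quadraticLocalEquiv E v c hcδ hδ (a, b) (PlacesOver.galInv c w) = toPlace v (PlacesOver.galInv c w) (a - splitSqrt F E c hcδ hδ v w * b) := by
  rw [quadraticLocalEquiv_apply_eq_toPlace_of_split E c hcδ hδ hd v (PlacesOver.galInv c w) (smul_galInv_ne E c hcδ hδ v w hw),
    splitSqrt_galInv F E c hcδ hδ hd v w hw, neg_mul, sub_eq_add_neg]

include hd in
/-- **`a² − d b² = (a + δ_w b)(a − δ_w b)`** (`d = δ_w²`, ★ `splitSqrt_mul_self`). [folklore] -/
theorem sq_sub_mul_sq_eq_mul_of_split (hw : c • w.1 ≠ w.1) (a b : v.adicCompletion F) :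
    a ^ 2 - (d : v.adicCompletion F) * b ^ 2 = (a + splitSqrt F E c hcδ hδ v w * b) * (a - splitSqrt F E c hcδ hδ v w * b) := by
  rw [← splitSqrt_mul_self F E c hcδ hδ hd v w hw]
  ring

include hd in
/-- **The corner at `w`**: `Z_w = ι_w(δ_w t − ½·x·x̄)`, `x = a + δ_w b`, `x̄ = a − δ_w b` (★ `corner_eq_quadraticLocalEquiv`, §1). [cite: CasselsFrohlichANT1967, Ch. II §10] -/
theorem corner_apply_eq_toPlace_of_split (hw : c • w.1 ≠ w.1) (a b t : v.adicCompletion F) :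
    (toLocalRing E v t * algebraMap E (LocalRing E v) δ -
        toLocalRing E v 2⁻¹ * (quadraticLocalEquiv E v c hcδ hδ (a, b) * conjLocal E c v (quadraticLocalEquiv E v c hcδ hδ (a, b)))) w =
      toPlace v w (splitSqrt F E c hcδ hδ v w * t - 2⁻¹ * (a + splitSqrt F E c hcδ hδ v w * b) * (a - splitSqrt F E c hcδ hδ v w * b)) := by
  rw [corner_eq_quadraticLocalEquiv E c hcδ hδ hd v a b t, quadraticLocalEquiv_apply_eq_toPlace_of_split E c hcδ hδ hd v w hw,
    sq_sub_mul_sq_eq_mul_of_split E c hcδ hδ hd v w hw]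
  congr 1
  ring

include hd in
/-- **The corner at `w̄`**: `Z_w̄ = ι_w̄(−(z − x·y))` with `x = a + δ_w b`, `y = −(a − δ_w b)`, `z = δ_w t − ½·x·(a − δ_w b)`. [cite: CasselsFrohlichANT1967, Ch. II §10] -/
theorem corner_apply_galInv_eq_toPlace_of_split (hw : c • w.1 ≠ w.1) (a b t : v.adicCompletion F) :
    (toLocalRing E v t * algebraMap E (LocalRing E v) δ -
        toLocalRing E v 2⁻¹ * (quadraticLocalEquiv E v c hcδ hδ (a, b) * conjLocal E c v (quadraticLocalEquiv E v c hcδ hδ (a, b)))) (PlacesOver.galInv c w) =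
      toPlace v (PlacesOver.galInv c w)
        (-((splitSqrt F E c hcδ hδ v w * t - 2⁻¹ * (a + splitSqrt F E c hcδ hδ v w * b) * (a - splitSqrt F E c hcδ hδ v w * b)) -
          (a + splitSqrt F E c hcδ hδ v w * b) * (-(a - splitSqrt F E c hcδ hδ v w * b)))) := by
  rw [corner_eq_quadraticLocalEquiv E c hcδ hδ hd v a b t, quadraticLocalEquiv_apply_galInv_eq_toPlace_of_split E c hcδ hδ hd v w hw,
    sq_sub_mul_sq_eq_mul_of_split E c hcδ hδ hd v w hw]
  congr 1
  ring

/-! ## §2 Norms at a split place: `‖ι_w y‖_w = ‖y‖_v` (`e = f = 1`) -/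

/-- **`‖ι_{w'} y‖_{w'} = ‖y‖_v` for both places `w'` above a split `v`** (`|ι y|_{w'} = |y|_v` ★ `valued_toPlace_of_split`, `q_{w'} = q_v` ★ `absNorm_eq_absNorm_under_of_smul_ne`;
`‖·‖ = q^{−ord}` ★ `normAbs_eq_inv_zpow_of_valued_eq`). [cite: CasselsFrohlichANT1967, Ch. II §10] -/
theorem normAbs_toPlace_of_split (w' : PlacesOver E v) (hw' : c • w'.1 ≠ w'.1) (y : v.adicCompletion F) :
    normAbs (w'.1.adicCompletion E) (toPlace v w' y) = normAbs (v.adicCompletion F) y := by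
  have hval := valued_toPlace_of_split F E c v w' hw' y
  have hq : w'.1.residueCard = v.residueCard := by
    have h := absNorm_eq_absNorm_under_of_smul_ne F c hw'
    rw [w'.2] at h
    exact h
  by_cases hy : y = 0
  · rw [hy, map_zero, map_zero, map_zero]
  · have hy' : Valued.v y ≠ 0 := (Valuation.ne_zero_iff _).2 hy
    have hn : Valued.v y = WithZero.exp (WithZero.log (Valued.v y)) := (WithZero.exp_log hy').symm
    rw [normAbs_eq_inv_zpow_of_valued_eq w'.1 (hval.trans hn), normAbs_eq_inv_zpow_of_valued_eq v hn, residueFieldCard_adicCompletion_eq,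
      residueFieldCard_adicCompletion_eq, hq]

/-! ## §3 HEAD: the height at a split place is the Gindikin–Karpelevich `GL₃` integrand -/

include hd in
/-- **THE `U(2,1)` BIG-CELL HEIGHT AT A SPLIT PLACE, IN GINDIKIN–KARPELEVICH COORDINATES.**  `v` split in `E` (`c • w ≠ w`, `w̄ = c⁻¹ • w`), `δ_w =` ★ `splitSqrt … v w`;
`X = Ψ_v(a, b)`, `Z = ι t·δ − ½X·σX` the last-row entries of `ι(w₀)·u(X, θ t)` (★ (a2)₃).  With `x := a + δ_w b`, `y := −(a − δ_w b)`, `z := δ_w t − ½·(a + δ_w b)(a − δ_w b)`: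
  **`max(1, ‖X_w‖, ‖Z_w‖) · max(1, ‖X_w̄‖, ‖Z_w̄‖) = max(1, |x|_v, |z|_v) · max(1, |y|_v, |z − x·y|_v)`**
— LITERALLY the integrand of ★ `K2E1GindikinKarpelevichSplitGL3.integral_bigCell_spherical_gl3_eq`; raised to `−σ` it is E1's flat section `H^σ` at the two places above `v`.
[cite: Langlands1971, §3] [cite: CasselsFrohlichANT1967, Ch. II §10] [cite: MoeglinWaldspurger1995, II.1.7] -/
theorem prod_max_one_norm_height_eq_gl3_of_split (hw : c • w.1 ≠ w.1) (a b t : v.adicCompletion F) :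
    max 1 (max ((normAbs (w.1.adicCompletion E) (quadraticLocalEquiv E v c hcδ hδ (a, b) w) : ℝ≥0) : ℝ)
        ((normAbs (w.1.adicCompletion E) ((toLocalRing E v t * algebraMap E (LocalRing E v) δ -
          toLocalRing E v 2⁻¹ * (quadraticLocalEquiv E v c hcδ hδ (a, b) * conjLocal E c v (quadraticLocalEquiv E v c hcδ hδ (a, b)))) w) : ℝ≥0) : ℝ)) *
      max 1 (max ((normAbs ((PlacesOver.galInv c w).1.adicCompletion E) (quadraticLocalEquiv E v c hcδ hδ (a, b) (PlacesOver.galInv c w)) : ℝ≥0) : ℝ)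
        ((normAbs ((PlacesOver.galInv c w).1.adicCompletion E) ((toLocalRing E v t * algebraMap E (LocalRing E v) δ -
          toLocalRing E v 2⁻¹ * (quadraticLocalEquiv E v c hcδ hδ (a, b) * conjLocal E c v (quadraticLocalEquiv E v c hcδ hδ (a, b)))) (PlacesOver.galInv c w)) : ℝ≥0) : ℝ)) =
      max 1 (max ((normAbs (v.adicCompletion F) (a + splitSqrt F E c hcδ hδ v w * b) : ℝ≥0) : ℝ)
          ((normAbs (v.adicCompletion F) (splitSqrt F E c hcδ hδ v w * t - 2⁻¹ * (a + splitSqrt F E c hcδ hδ v w * b) * (a - splitSqrt F E c hcδ hδ v w * b)) : ℝ≥0) : ℝ)) *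
        max 1 (max ((normAbs (v.adicCompletion F) (-(a - splitSqrt F E c hcδ hδ v w * b)) : ℝ≥0) : ℝ)
          ((normAbs (v.adicCompletion F)
            ((splitSqrt F E c hcδ hδ v w * t - 2⁻¹ * (a + splitSqrt F E c hcδ hδ v w * b) * (a - splitSqrt F E c hcδ hδ v w * b)) -
              (a + splitSqrt F E c hcδ hδ v w * b) * (-(a - splitSqrt F E c hcδ hδ v w * b))) : ℝ≥0) : ℝ)) := by
  have hw' := smul_galInv_ne E c hcδ hδ v w hw
  rw [quadraticLocalEquiv_apply_eq_toPlace_of_split E c hcδ hδ hd v w hw, corner_apply_eq_toPlace_of_split E c hcδ hδ hd v w hw,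
    quadraticLocalEquiv_apply_galInv_eq_toPlace_of_split E c hcδ hδ hd v w hw, corner_apply_galInv_eq_toPlace_of_split E c hcδ hδ hd v w hw,
    normAbs_toPlace_of_split E c v w hw, normAbs_toPlace_of_split E c v w hw,
    normAbs_toPlace_of_split E c v (PlacesOver.galInv c w) hw', normAbs_toPlace_of_split E c v (PlacesOver.galInv c w) hw',
    normAbs_neg, normAbs_neg]

include hd in
/-- **THE SAME FOR THE PRODUCT OVER ALL PLACES ABOVE `v`** (`{w' ∣ v} = {w, w̄}`, ★ `PlacesOver.eq_or_eq_galInv`, ★ `PlacesOver.galInv_ne`): the finite height factor of E1's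
flat section at a split `v`, `∏_{w'∣v} max(1, ‖X_{w'}‖, ‖Z_{w'}‖)`, is the Gindikin–Karpelevich integrand `max(1,|x|,|z|)·max(1,|y|,|z − xy|)`.
[cite: Langlands1971, §3] [cite: CasselsFrohlichANT1967, Ch. II §10] -/
theorem prod_placesOver_max_one_norm_height_eq_gl3_of_split (hw : c • w.1 ≠ w.1) (a b t : v.adicCompletion F) :
    ∏ w' : PlacesOver E v, max 1 (max ((normAbs (w'.1.adicCompletion E) (quadraticLocalEquiv E v c hcδ hδ (a, b) w') : ℝ≥0) : ℝ)
        ((normAbs (w'.1.adicCompletion E) ((toLocalRing E v t * algebraMap E (LocalRing E v) δ -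
          toLocalRing E v 2⁻¹ * (quadraticLocalEquiv E v c hcδ hδ (a, b) * conjLocal E c v (quadraticLocalEquiv E v c hcδ hδ (a, b)))) w') : ℝ≥0) : ℝ)) =
      max 1 (max ((normAbs (v.adicCompletion F) (a + splitSqrt F E c hcδ hδ v w * b) : ℝ≥0) : ℝ)
          ((normAbs (v.adicCompletion F) (splitSqrt F E c hcδ hδ v w * t - 2⁻¹ * (a + splitSqrt F E c hcδ hδ v w * b) * (a - splitSqrt F E c hcδ hδ v w * b)) : ℝ≥0) : ℝ)) *
        max 1 (max ((normAbs (v.adicCompletion F) (-(a - splitSqrt F E c hcδ hδ v w * b)) : ℝ≥0) : ℝ)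
          ((normAbs (v.adicCompletion F)
            ((splitSqrt F E c hcδ hδ v w * t - 2⁻¹ * (a + splitSqrt F E c hcδ hδ v w * b) * (a - splitSqrt F E c hcδ hδ v w * b)) -
              (a + splitSqrt F E c hcδ hδ v w * b) * (-(a - splitSqrt F E c hcδ hδ v w * b))) : ℝ≥0) : ℝ)) := by
  classical
  have hc1 : c ≠ 1 := ne_one_of_apply_eq_neg E c hcδ hδ
  have hne : PlacesOver.galInv c w ≠ w := PlacesOver.galInv_ne c w hw
  have huniv : (Finset.univ : Finset (PlacesOver E v)) = {w, PlacesOver.galInv c w} := by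
    ext w'
    simp only [Finset.mem_univ, Finset.mem_insert, Finset.mem_singleton, true_iff]
    exact PlacesOver.eq_or_eq_galInv c hc1 w w'
  rw [huniv, Finset.prod_pair hne.symm]
  exact prod_max_one_norm_height_eq_gl3_of_split E c hcδ hδ hd v w hw a b t

end Summit.HodgeConjecture.HodgeConjecture.Cruxes.H413.K2E1IntertwiningLocalFactorU3HeightSplit

end
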